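import Summits.Ventures.HodgeRepro2.T6N1WitMain
import Summits.Ventures.HodgeRepro2.T6N3Toy2V

/-!
# T6N3WitInstance — the N3 + N2 pieces of the joint toy v2 on t6-p1's non-degenerate N1 witness

Cell pub-hodge-repro2, Tier 6 (README §10), seat t6-p3 (N3 owner, M2). Proof lane; count-neutral.
The (β) file of the lead's word (STATUS ll. 11351 (2) / 11364 (1)): t6-p1's non-degenerate N1 instance
(T6N1WitMain: the period datum `D.ndatum σ₀`, the automorphic space `LGw K = ℓ²` on the pair indices,
the re-cut dictionary `scP`, the vertex-form products `f_A = scP ω_A`, `f_B = scP ω_B`, the parameters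
`FA c = (c.1 c.2.1) • f_A`, `FB c = (c.2.2.1 c.2.2.2) • f_B`) is given its N3 datum
`witN3 := N3ToyV.toyVW (LGw K) f_A f_B` (side A on `f_A`, side B on `f_B`) and its ℚ-rational N2
datum `witN2 := N2ToyIsoS.toyIsoSF … ratSet⁴`, so that
* the products of `witN3` at the data of a choice ARE t6-p1's parameters (`witN3_A_F`, `witN3_B_F`,
  `witN3_pairing` — all `rfl`): a carrier with `d3 := witN3`, `data := id`, `d1 := D.n1datum σ₀`
  type-checks as is;
* `f_A ≠ 0`, `f_B ≠ 0`, `⟪f_B, f_A⟫ ≠ 0` (from t6-p1's `pairing_ne_zero` at the unit choice);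
* the `data_adm'` field of the carrier is witnessed by the unit choice `(1, 1, 1, 1)`
  (`data_adm'_witness`);
* `hAdm` (the sentence N2 and N3 share), `hN2` and the ℚ-rational admissibility of the unit quadruple
  hold on `witN2` outright;
* the (α) scalar `f_B ∈ ℂ ∙ f_A` (`witN3_hw`, from t6-p1's `scP_omegaB_eq_smul` on the re-cut
  dictionary `scP` — the N3 seam FORCES it: T6N3TrivGroup `span_eq_of_products_on_lines`; the
  generic construction behind the re-cut is T6N3GramRow), hence every binder of `N3iso_main₃` but
  `hAdm` (`witN3_N3iso_binders`), `hσ` (`witN3_hσ`), `ℓ_A, ℓ_B ≢ 0` (`witN3_ellNonzero`) and the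
  isotypic step with a ℚ-rational admissible witness (`witN3_N3iso₂`) hold outright.
t6-p6's assembly T6PeriodInput6Toy2 consumes these names (STATUS l. 11382 (1)).

§8(d): uses an L-value-free non-vanishing device: NO.
-/
namespace Summit.Ventures.HodgeRepro2.T6.N3WitInstance

open scoped InnerProductSpace
open Summit.Ventures.HodgeRepro2.T6
open Summit.Ventures.HodgeRepro2.T6.N1Wit

variable {K : Type} [Field K] [NumberField K] {F : FaceSetting K} (D : WitData F) (σ₀ : K →+* ℂ)

/-- `f_A := scP(ω_A)` — t6-p1's vertex-form product of side A at the unit choice (the re-cut dictionary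
`scP` of T6N1WitGram2, the rank factorisation of the `(★)` block). -/
noncomputable abbrev fA : WitData.LGw K := D.scP σ₀ (D.omegaA σ₀)

/-- `f_B := scP(ω_B)`. -/
noncomputable abbrev fB : WitData.LGw K := D.scP σ₀ (D.omegaB σ₀)

/-- THE N3 DATUM OF THE JOINT TOY v2 on t6-p1's automorphic space `LGw K`: the toy N3 datum with side A
on `f_A` and side B on `f_B` (`N3ToyV.toyVW`). -/
noncomputable abbrev witN3 : N3Datum := N3ToyV.toyVW (WitData.LGw K) (fA D σ₀) (fB D σ₀)

/-- The products of side A at the data of a choice ARE t6-p1's `FA c` (definitionally). -/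
theorem witN3_A_F (c : (D.ndatum σ₀).Choice) : (witN3 D σ₀).A.F c.1 c.2.1 = D.FA σ₀ c := rfl

/-- The products of side B at the data of a choice ARE t6-p1's `FB c` (definitionally). -/
theorem witN3_B_F (c : (D.ndatum σ₀).Choice) :
    (witN3 D σ₀).B.F c.2.2.1 c.2.2.2 = D.FB σ₀ c := rfl

/-- The pairing of the products at the data of `c` IS t6-p1's `pairing c` (definitionally). -/
theorem witN3_pairing (c : (D.ndatum σ₀).Choice) :
    ⟪(witN3 D σ₀).B.F c.2.2.1 c.2.2.2, (witN3 D σ₀).A.F c.1 c.2.1⟫_ℂ = (D.n1datum σ₀).pairing c :=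
  rfl

/-- The unit choice is admissible (normalised). -/
theorem admChoice_one : (D.ndatum σ₀).AdmChoice (1, 1, 1, 1) := ⟨mul_one 1, mul_one 1⟩

/-- `⟪f_B, f_A⟫ ≠ 0` (t6-p1's `pairing_ne_zero` at the unit choice). -/
theorem inner_fB_fA_ne_zero : ⟪fB D σ₀, fA D σ₀⟫_ℂ ≠ 0 := by
  have h := D.pairing_ne_zero σ₀ (1, 1, 1, 1) (admChoice_one D σ₀)
  have e : (D.n1datum σ₀).pairing (1, 1, 1, 1) = ⟪fB D σ₀, fA D σ₀⟫_ℂ := by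
    show ⟪(1 * 1 : ℂ) • fB D σ₀, (1 * 1 : ℂ) • fA D σ₀⟫_ℂ = _
    simp
  rwa [e] at h

/-- `f_A ≠ 0`. -/
theorem fA_ne_zero : fA D σ₀ ≠ 0 := fun h =>
  inner_fB_fA_ne_zero D σ₀ (by rw [h, inner_zero_right])

/-- `f_B ≠ 0`. -/
theorem fB_ne_zero : fB D σ₀ ≠ 0 := fun h =>
  inner_fB_fA_ne_zero D σ₀ (by rw [h, inner_zero_left])

/-- The unit products of `witN3` have the non-zero pairing `⟪f_B, f_A⟫`. -/
theorem witN3_pairing_one_ne_zero :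
    ⟪(witN3 D σ₀).B.F 1 1, (witN3 D σ₀).A.F 1 1⟫_ℂ ≠ 0 := by
  rw [N3ToyV.toyVW_pairing_one]
  exact inner_fB_fA_ne_zero D σ₀

/-- THE `data_adm'` FIELD OF THE JOINT CARRIER at `data := id`: an admissible quadruple with non-zero
pairing gives the admissible unit choice `(1, 1, 1, 1)`, whose pairing is non-zero. -/
theorem data_adm'_witness (φa φb φc φd : ℂ)
    (_hne : ⟪(witN3 D σ₀).B.F φc φd, (witN3 D σ₀).A.F φa φb⟫_ℂ ≠ 0) :
    ∃ c : (D.ndatum σ₀).Choice, (D.ndatum σ₀).AdmChoice c ∧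
      ⟪(witN3 D σ₀).B.F c.2.2.1 c.2.2.2, (witN3 D σ₀).A.F c.1 c.2.1⟫_ℂ ≠ 0 :=
  ⟨(1, 1, 1, 1), admChoice_one D σ₀, witN3_pairing_one_ne_zero D σ₀⟩

section Scalar

/-- THE (α) SCALAR (the lead's l. 11351 (2) / l. 11364 (1)): `f_B ∈ ℂ ∙ f_A` — t6-p1's
`scP_omegaB_eq_smul` on the re-cut dictionary (the N3 seam FORCES it: T6N3TrivGroup
`span_eq_of_products_on_lines`). -/
theorem witN3_hw : fB D σ₀ ∈ ℂ ∙ fA D σ₀ := by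
  obtain ⟨l, _, hl⟩ := D.scP_omegaB_eq_smul σ₀
  show D.scP σ₀ (D.omegaB σ₀) ∈ ℂ ∙ D.scP σ₀ (D.omegaA σ₀)
  rw [hl]
  exact Submodule.smul_mem _ _ (Submodule.mem_span_singleton_self _)

/-- `hσ` on `witN3`. -/
theorem witN3_hσ : (witN3 D σ₀).B.σ = (witN3 D σ₀).A.σ :=
  N3ToyV.toyVW_hσ (witN3_hw D σ₀) (fB_ne_zero D σ₀)

/-- EVERY binder of `N3iso_main₃` other than `hAdm` on `witN3`. -/
theorem witN3_N3iso_binders :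
    Hyp.Rogawski1990_Sec14_6_Partition N3Toy.toyR ∧ Hyp.Rogawski1990_Thm14_6_4 N3Toy.toyR ∧
      Hyp.Rogawski1990_Thm14_6_5 N3Toy.toyR ∧
      (∀ P' ∈ N3Toy.toyR.Ps, ∀ π, N3Toy.toyR.mem π P' → N3Toy.toyR.m π ≤ 1) ∧
      (witN3 D σ₀).RogawskiBridge N3Toy.toyR (N3ToyV.toyVW_AutStable _ _) ∧
      (witN3 D σ₀).AutOrthogonal ∧ (witN3 D σ₀).AutSimple ∧
      (witN3 D σ₀).ProductsIn20 (witN3 D σ₀).A ∧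
      (witN3 D σ₀).ProductEquivariant (witN3 D σ₀).A ∧
      (witN3 D σ₀).ProductsIn20 (witN3 D σ₀).B ∧
      (witN3 D σ₀).ProductEquivariant (witN3 D σ₀).B ∧
      (witN3 D σ₀).SigmaIsAut (witN3 D σ₀).A ∧ (witN3 D σ₀).B.σ = (witN3 D σ₀).A.σ :=
  N3ToyV.toyVW_N3iso_binders (witN3_hw D σ₀) (fB_ne_zero D σ₀)

/-- `ℓ_A ≠ 0` and `ℓ_B ≠ 0` on `witN3`. -/
theorem witN3_ellNonzero :
    (witN3 D σ₀).ellNonzero (witN3 D σ₀).A ∧ (witN3 D σ₀).ellNonzero (witN3 D σ₀).B :=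
  ⟨N3ToyV.toyVW_N3A (fA_ne_zero D σ₀) _, N3ToyV.toyVW_N3B _ (fB_ne_zero D σ₀)⟩

end Scalar

section N2

variable [NumberField.IsCMField K]

/-- THE N2 DATUM OF THE JOINT TOY v2: t6-p5's explicit-isometry datum over `witN3` with ℚ-RATIONAL
admissible sets. -/
noncomputable abbrev witN2 : N2Datum F (D.ndatum σ₀) (witN3 D σ₀) :=
  N2ToyIsoS.toyIsoSF F (D.ndatum σ₀) (witN3 D σ₀) N3ToyV.ratSet N3ToyV.ratSet N3ToyV.ratSet
    N3ToyV.ratSet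

/-- `hAdm`: the sentence N2 and N3 share on `witN2`. -/
theorem witN2_admGenerating : (witN2 D σ₀).AdmGenerating :=
  N3ToyV.toyIsoSF_rat_admGenerating F (D.ndatum σ₀) _ _

/-- `hN2`: the N2 conclusion on `witN2`, no hypothesis. -/
theorem witN2_adm : (witN2 D σ₀).Adm :=
  N2ToyIsoS.toyIsoSF_adm F (D.ndatum σ₀) (witN3 D σ₀) _ _ _ _

/-- The unit quadruple is ℚ-rational admissible. -/
theorem witN2_admData_one : (witN2 D σ₀).AdmData (1, 1, 1, 1) :=
  N3ToyV.toyVW_admData_one F (D.ndatum σ₀) _ _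

/-- THE ISOTYPIC STEP ON THE JOINT TOY with the ℚ-rational witness (every binder of
`N3iso_of_datum₂_gen` discharged). -/
theorem witN3_N3iso₂ :
    ∃ (φa : (witN3 D σ₀).A.Sa) (φb : (witN3 D σ₀).A.Sb) (φc : (witN3 D σ₀).B.Sa)
      (φd : (witN3 D σ₀).B.Sb), (witN2 D σ₀).AdmData (φa, φb, φc, φd) ∧
        ⟪(witN3 D σ₀).B.F φc φd, (witN3 D σ₀).A.F φa φb⟫_ℂ ≠ 0 :=
  N3ToyV.toyVW_N3iso₂ F (D.ndatum σ₀) (fA_ne_zero D σ₀) (witN3_hw D σ₀) (fB_ne_zero D σ₀)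

end N2

end Summit.Ventures.HodgeRepro2.T6.N3WitInstance
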